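import Mathlib
import Summits.Ventures.PercRepro.TriangleCapMaxDegStability3

/-!
# PercRepro — THE VERTEX BOUND: a triangle-free graph with `s` edges and a vertex `w` of degree `x` has
`Σ_v d(v)² + 2 (s − x)(x − 1) ≤ s (s + 1)`, i.e. `Σ_v d(v)² ≤ x² + (s − x)² + 3 (s − x) + x`; and the stability of the
pair count at every level: every degree `≤ s − j − 1` (`s ≥ 4j + 3`) gives `Σ_v d(v)² + 2 (j + 1)(s − j − 2) ≤ s (s + 1)`
(p3, gen 48; part 201g)

The pair count of part 200q read at an ARBITRARY vertex `w` (of degree `x`): every ordered adjacent pair off `w`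
avoids `≥ x − 1` edges at `w` (`nonIncident_ge_of_off`) and the pairs at `w` avoid `≥ (s − x)(x − 1)` edges in all
(`sum_nonIncident_at_ge`), so `Σ d² + 2 (s − x)(x − 1) ≤ s (s + 1)` — the star stability (`x = s − 1`: `2 (s − 2)`),
the max-degree stabilities (`x = s − 2`: `4 (s − 3)`; `x = s − 3`: `6 (s − 4)`) and the exact maximum `x² + (s − x)² +
3 (s − x) + x` for a prescribed degree at one vertex (two nested stars) in one statement. The level-`j` stability
follows at a vertex of maximum degree `Δ`: for `j + 2 ≤ Δ ≤ s − j − 1` the concave `(s − Δ)(Δ − 1)` is at least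
`(j + 1)(s − j − 2)`, and for `Δ ≤ j + 1` every `d² ≤ (j + 1) d` gives `Σ d² ≤ 2 (j + 1) s`. On the bipartite class:
a spanning subgraph of `K(A, Aᶜ)` with `s` missing pairs, `x` of them at a vertex `w`, is `2 (s − x)(x − 1)` below its
closed form; with no vertex missing `s − j − 1` of them it is `2 (j + 1)(s − j − 2)` below — the all-off read of every
row `r = a + j` of the stability table. Axioms: standard.
-/

namespace PercRepro

namespace TriangleCap

namespace C047

open Finset

variable {V : Type*} [Fintype V] [DecidableEq V]

/-- **THE VERTEX BOUND:** a triangle-free graph with `s` edges and a vertex `w` of degree `x` has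
`Σ_v d(v)² + 2 (s − x)(x − 1) ≤ s (s + 1)`. -/
theorem sum_deg_sq_le_of_vertex (H : SimpleGraph V) [DecidableRel H.Adj] (hfree : H.CliqueFree 3) (w : V) :
    ∑ v, deg H v * deg H v + 2 * ((H.edgeFinset.card - deg H w) * (deg H w - 1)) ≤
      H.edgeFinset.card * (H.edgeFinset.card + 1) := by
  have hsum := sum_adjPairsAll_nonIncident_eq H
  rw [sum_adjPairsAll_deg_add] at hsum
  have hoff : (H.edgeFinset.filter (fun e => w ∉ e)).card + deg H w = H.edgeFinset.card := by
    have := card_filter_add_card_filter_not (s := H.edgeFinset) (fun e => w ∉ e)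
    have h2 : H.edgeFinset.filter (fun e => ¬ w ∉ e) = H.incidenceFinset w := by
      ext e
      simp only [mem_filter, SimpleGraph.mem_incidenceFinset, SimpleGraph.mem_edgeFinset, not_not]
      rfl
    rw [h2, ← deg_eq_card_incidenceFinset] at this
    exact this
  have hsplit := sum_filter_add_sum_filter_not (adjPairsAll H) (fun p : V × V => p.1 ≠ w ∧ p.2 ≠ w)
    (fun p => nonIncident H p.1 p.2)
  have hP1 : ((adjPairsAll H).filter (fun p : V × V => p.1 ≠ w ∧ p.2 ≠ w)).card * (deg H w - 1) ≤
      ∑ p ∈ (adjPairsAll H).filter (fun p : V × V => p.1 ≠ w ∧ p.2 ≠ w), nonIncident H p.1 p.2 := by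
    rw [← smul_eq_mul, ← sum_const]
    apply sum_le_sum
    intro p hp
    rw [mem_filter, mem_adjPairsAll] at hp
    have := nonIncident_ge_of_off H hfree w hp.1 hp.2.1 hp.2.2
    omega
  have hP2 := sum_nonIncident_at_eq H w
  have hP2' := sum_nonIncident_at_ge H hfree w
  have hcard := card_adjPairs_off_vertex H w
  set s' := (H.edgeFinset.filter (fun e => w ∉ e)).card with hs'
  set Δ := deg H w with hΔ'
  clear_value s' Δ
  rw [← hsplit] at hsum
  have hP1' : 2 * s' * (Δ - 1) ≤
      ∑ p ∈ (adjPairsAll H).filter (fun p : V × V => p.1 ≠ w ∧ p.2 ≠ w), nonIncident H p.1 p.2 := by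
    have : ((adjPairsAll H).filter (fun p : V × V => p.1 ≠ w ∧ p.2 ≠ w)).card = 2 * s' := by omega
    rw [this] at hP1
    exact hP1
  have hsΔ : H.edgeFinset.card - Δ = s' := by omega
  rw [hsΔ]
  nlinarith [hsum, hP1', hP2, hP2']

/-- The arithmetic of the level-`j` stability: `j + 2 ≤ Δ ≤ s − j − 1` ⇒ `(j + 1)(s − j − 2) ≤ (s − Δ)(Δ − 1)`. -/
theorem level_concave (s Δ j : ℕ) (h1 : j + 2 ≤ Δ) (h2 : Δ + j + 1 ≤ s) :
    (j + 1) * (s - j - 2) ≤ (s - Δ) * (Δ - 1) := by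
  obtain ⟨u, rfl⟩ : ∃ u, Δ = j + 2 + u := ⟨Δ - (j + 2), by omega⟩
  obtain ⟨v, rfl⟩ : ∃ v, s = j + 2 + u + j + 1 + v := ⟨s - (j + 2 + u + j + 1), by omega⟩
  have e1 : j + 2 + u + j + 1 + v - j - 2 = j + 1 + u + v := by omega
  have e2 : j + 2 + u + j + 1 + v - (j + 2 + u) = j + 1 + v := by omega
  have e3 : j + 2 + u - 1 = j + 1 + u := by omega
  rw [e1, e2, e3]
  nlinarith [Nat.zero_le (u * v)]

/-- **THE STABILITY OF THE PAIR COUNT AT LEVEL `j`:** a triangle-free graph with `s ≥ 4j + 3` edges and every degree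
`≤ s − j − 1` has `Σ_v d(v)² + 2 (j + 1)(s − j − 2) ≤ s (s + 1)` (the `(s − j − 1)`-star plus a `(j + 1)`-star sharing
leaves is extremal). -/
theorem sum_deg_sq_le_of_maxdeg_level (H : SimpleGraph V) [DecidableRel H.Adj] (hfree : H.CliqueFree 3) (j : ℕ)
    (hs : 4 * j + 3 ≤ H.edgeFinset.card) (hΔ : ∀ v, deg H v + j + 1 ≤ H.edgeFinset.card) :
    ∑ v, deg H v * deg H v + 2 * ((j + 1) * (H.edgeFinset.card - j - 2)) ≤
      H.edgeFinset.card * (H.edgeFinset.card + 1) := by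
  have hne : (univ : Finset V).Nonempty := by
    obtain ⟨e, he⟩ := card_pos.mp (by omega : 0 < H.edgeFinset.card)
    revert he
    refine Sym2.ind (fun x y _ => ⟨x, mem_univ x⟩) e
  obtain ⟨v₀, -, hmax⟩ := exists_max_image univ (fun v => deg H v) hne
  rcases Nat.lt_or_ge (deg H v₀) (j + 2) with hsmall | hbig
  · -- every degree `≤ j + 1`: `Σ d² ≤ (j + 1) Σ d = 2 (j + 1) s`
    have hall : ∀ v, deg H v * deg H v ≤ (j + 1) * deg H v := by
      intro v
      have := hmax v (mem_univ v)
      exact Nat.mul_le_mul_right _ (by omega)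
    have h3 := sum_deg_eq H
    have h4 : ∑ v, deg H v * deg H v ≤ ∑ v, (j + 1) * deg H v := sum_le_sum (fun v _ => hall v)
    rw [← mul_sum, h3] at h4
    obtain ⟨m', hm'⟩ : ∃ m', H.edgeFinset.card = 4 * j + 3 + m' := ⟨H.edgeFinset.card - (4 * j + 3), by omega⟩
    rw [hm'] at h4 ⊢
    have e : 4 * j + 3 + m' - j - 2 = 3 * j + 1 + m' := by omega
    rw [e]
    nlinarith [h4, Nat.zero_le (j * m')]
  · have h := sum_deg_sq_le_of_vertex H hfree v₀
    have hc := level_concave H.edgeFinset.card (deg H v₀) j hbig (hΔ v₀)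
    omega

/-- **THE VERTEX BOUND ON THE BIPARTITE CLASS:** a spanning subgraph of `K(A, Aᶜ)`, `|A| = a`, with `s` missing cross
pairs (`s + 1 ≤ k`), `x` of them at the vertex `w`, has `Σ_v d(v)² + s (k − 1 − s) + 2 (s − x)(x − 1) ≤ m k`. -/
theorem closed_form_stability_bipSub_vertex (D : SimpleGraph V) [DecidableRel D.Adj] (A : Finset V)
    (hD : BipSub D A) (a s : ℕ) (hA : A.card = a) (hm : D.edgeFinset.card + s = a * (Fintype.card V - a))
    (hs1 : s + 1 ≤ Fintype.card V) (w : V) :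
    ∑ v, deg D v * deg D v + s * (Fintype.card V - 1 - s) +
        2 * ((s - deg (missingGraph D A) w) * (deg (missingGraph D A) w - 1)) ≤
      D.edgeFinset.card * Fintype.card V := by
  have key := sum_deg_sq_bipSub D A hD
  have hM := card_edges_missingGraph D A hD a s hA hm
  rw [hM, hA] at key
  have hfree := cliqueFree_of_bipSub (missingGraph D A) A (bipSub_missingGraph D A)
  have hstab := sum_deg_sq_le_of_vertex (missingGraph D A) hfree w
  rw [hM] at hstab
  obtain ⟨t, ht⟩ : ∃ t, Fintype.card V = s + 1 + t := ⟨_, (Nat.add_sub_cancel' hs1).symm⟩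
  have e : s + 1 + t - 1 - s = t := by omega
  rw [ht, e]
  rw [ht] at key hm
  generalize hS : ∑ v, deg D v * deg D v = S at key
  generalize hH : ∑ v, deg (missingGraph D A) v * deg (missingGraph D A) v = H at key hstab
  generalize hM' : D.edgeFinset.card = M at key hm
  generalize hP : a * (s + 1 + t - a) = P at key hm
  generalize hx : (s - deg (missingGraph D A) w) * (deg (missingGraph D A) w - 1) = X at hstab ⊢
  nlinarith [key, hm, hstab]

/-- **THE LEVEL-`j` STABILITY ON THE BIPARTITE CLASS:** a spanning subgraph of `K(A, Aᶜ)`, `|A| = a`, with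
`s ≥ 4j + 3` missing cross pairs (`s + 1 ≤ k`), no vertex missing more than `s − j − 1` of them, has
`Σ_v d(v)² + s (k − 1 − s) + 2 (j + 1)(s − j − 2) ≤ m k`. -/
theorem closed_form_stability_bipSub_level (D : SimpleGraph V) [DecidableRel D.Adj] (A : Finset V)
    (hD : BipSub D A) (a s j : ℕ) (hA : A.card = a) (hm : D.edgeFinset.card + s = a * (Fintype.card V - a))
    (hs1 : s + 1 ≤ Fintype.card V) (hs4 : 4 * j + 3 ≤ s) (hmax : ∀ v, deg (missingGraph D A) v + j + 1 ≤ s) :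
    ∑ v, deg D v * deg D v + s * (Fintype.card V - 1 - s) + 2 * ((j + 1) * (s - j - 2)) ≤
      D.edgeFinset.card * Fintype.card V := by
  have key := sum_deg_sq_bipSub D A hD
  have hM := card_edges_missingGraph D A hD a s hA hm
  rw [hM, hA] at key
  have hfree := cliqueFree_of_bipSub (missingGraph D A) A (bipSub_missingGraph D A)
  have hstab := sum_deg_sq_le_of_maxdeg_level (missingGraph D A) hfree j (by rw [hM]; exact hs4)
    (fun v => by rw [hM]; exact hmax v)
  rw [hM] at hstab
  obtain ⟨t, ht⟩ : ∃ t, Fintype.card V = s + 1 + t := ⟨_, (Nat.add_sub_cancel' hs1).symm⟩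
  have e : s + 1 + t - 1 - s = t := by omega
  rw [ht, e]
  rw [ht] at key hm
  generalize hS : ∑ v, deg D v * deg D v = S at key
  generalize hH : ∑ v, deg (missingGraph D A) v * deg (missingGraph D A) v = H at key hstab
  generalize hM' : D.edgeFinset.card = M at key hm
  generalize hP : a * (s + 1 + t - a) = P at key hm
  generalize hx : (j + 1) * (s - j - 2) = X at hstab ⊢
  nlinarith [key, hm, hstab]

end C047

end TriangleCap

end PercRepro
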